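import Summits.AtomisticToContinuum.Crystallization.Theorems.PricedLinkCensusTruncatedCensusGapGapOfPeriodicPricing
import Summits.AtomisticToContinuum.Crystallization.Theorems.PricedLinkCensusTruncatedCensusGapPeriodicStability
import Literature.MathematicalPhysics.StatisticalMechanics.BarlowStacking

/-!
# `TruncatedCensusGap` (stmt-AtomisticToContinuum-14230): the HCP-REFERENCE SPLIT of the crux

Lead c3 of line `sharp-m-potential-compactness`.  By the periodic form of the crux
(`truncatedCensusGap_of_periodicPricing`, p127773) the crux follows from the periodic pricing
relative to the (unknown) periodic infimum `e_χ*`.  Replacing `e_χ*` by the energy of an EXPLICIT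
charge-free reference — the hcp periodic configuration `hcpPeriodicConfiguration ha hh` at some
scale `(a, h)` (`e_χ* ≤ e_χ(hcp a h)` always) — gives a STRONGER, typed, two-piece sufficient
condition whose pieces are of very different status:

* **(CF-OPT) charge-free optimality of hcp**: every periodic configuration all of whose motif sites
  are charge-free at tolerance `1/100` has `e_χ(hcp a h) ≤ e_χ(Q)`.  Charge-freeness is a RIGID
  hypothesis (12 bonds, all rings 4, at 1 %): by the route's geometric items SoftFourRings /
  SoftLayerPropagation (stmt-…-14234 / 14233) such a `Q` is a `1 %`-strained Barlow stacking, whose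
  energy is controlled by the affine stacking law of the range-2 potential, harmonic coercivity and
  a two-parameter `(a, h)` landscape — an ATTAINABLE target (perturbative + certified numerics).
* **(CH-PRICE) charged pricing relative to hcp**: every periodic configuration with at least one
  charged motif site pays `κ` per charged site above `e_χ(hcp a h)`.  This is the open,
  non-perturbative content of the crux ("hcp* dominates every charged periodic structure, linearly
  in the charged density") in its sharpest form.

`truncatedCensusGap_of_hcpSplit : (∃ a h ha hh, CF-OPT ∧ CH-PRICE) → TruncatedCensusGap`
(glue: `e_χ* ≤ e_χ(hcp a h)` by periodic stability, p84999, and the periodic form).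
`[folklore]` bookkeeping; offered to the crux strategist as a typed decomposition.
-/

noncomputable section

namespace Summit.AtomisticToContinuum.Crystallization.Theorems.PricedLinkCensusTruncatedCensusGap

open Literature.MathematicalPhysics.StatisticalMechanics Literature.Geometry.DiscreteGeometry
open Summit.AtomisticToContinuum.Crystallization.Theorems.ChargedEnergyGapNegative (motifCharged)

/-- **The hcp-reference split implies the crux**: charge-free optimality of an hcp configuration
plus charged pricing relative to it give the periodic pricing relative to `e_χ*` (since
`e_χ* ≤ e_χ(hcp a h)`), hence `TruncatedCensusGap` by the periodic form. [folklore] -/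
theorem truncatedCensusGap_of_hcpSplit : (∃ (a h : ℝ) (ha : a ≠ 0) (hh : h ≠ 0), (∀ Q : PeriodicConfiguration 3, Summit.AtomisticToContinuum.Crystallization.Theorems.ChargedEnergyGapNegative.motifCharged (1 / 100) Q = 0 → (hcpPeriodicConfiguration ha hh).energyPerParticle (fun r => min 1 (max 0 (4 - 2 * r)) * lennardJones r) ≤ Q.energyPerParticle (fun r => min 1 (max 0 (4 - 2 * r)) * lennardJones r)) ∧ (∃ κ : ℝ, 0 < κ ∧ ∀ Q : PeriodicConfiguration 3, 1 ≤ Summit.AtomisticToContinuum.Crystallization.Theorems.ChargedEnergyGapNegative.motifCharged (1 / 100) Q → κ * (Summit.AtomisticToContinuum.Crystallization.Theorems.ChargedEnergyGapNegative.motifCharged (1 / 100) Q : ℝ) ≤ (Q.motif.card : ℝ) * (Q.energyPerParticle (fun r => min 1 (max 0 (4 - 2 * r)) * lennardJones r) - (hcpPeriodicConfiguration ha hh).energyPerParticle (fun r => min 1 (max 0 (4 - 2 * r)) * lennardJones r)))) → Summit.AtomisticToContinuum.Crystallization.Theses.PricedLinkCensus.TruncatedCensusGap := by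
  rintro ⟨a, h, ha, hh, hcf, κ, hκ, hch⟩
  refine truncatedCensusGap_of_periodicPricing ⟨κ, hκ, fun Q => ?_⟩
  have hB := stub_periodicStability
  have hstar : (⨅ Q' : PeriodicConfiguration 3, Q'.energyPerParticle (fun r => min 1 (max 0 (4 - 2 * r)) * lennardJones r)) ≤
      Q.energyPerParticle (fun r => min 1 (max 0 (4 - 2 * r)) * lennardJones r) := ciInf_le hB Q
  have hhcp : (⨅ Q' : PeriodicConfiguration 3, Q'.energyPerParticle (fun r => min 1 (max 0 (4 - 2 * r)) * lennardJones r)) ≤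
      (hcpPeriodicConfiguration ha hh).energyPerParticle (fun r => min 1 (max 0 (4 - 2 * r)) * lennardJones r) := ciInf_le hB _
  have hF : (0 : ℝ) ≤ Q.motif.card := Nat.cast_nonneg _
  rcases Nat.eq_zero_or_pos (motifCharged (1 / 100) Q) with h0 | hpos
  · rw [h0, Nat.cast_zero, mul_zero]
    exact mul_nonneg hF (sub_nonneg.2 hstar)
  · have h1 := hch Q hpos
    have h2 : (Q.motif.card : ℝ) * (Q.energyPerParticle (fun r => min 1 (max 0 (4 - 2 * r)) * lennardJones r) -
        (hcpPeriodicConfiguration ha hh).energyPerParticle (fun r => min 1 (max 0 (4 - 2 * r)) * lennardJones r)) ≤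
        (Q.motif.card : ℝ) * (Q.energyPerParticle (fun r => min 1 (max 0 (4 - 2 * r)) * lennardJones r) -
          ⨅ Q' : PeriodicConfiguration 3, Q'.energyPerParticle (fun r => min 1 (max 0 (4 - 2 * r)) * lennardJones r)) :=
      mul_le_mul_of_nonneg_left (by linarith) hF
    exact h1.trans h2

end Summit.AtomisticToContinuum.Crystallization.Theorems.PricedLinkCensusTruncatedCensusGap

end
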